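import Summits.RiemannHypothesis.RiemannHypothesis.Theorems.RobinHighStaircaseRowsH18to21
import Summits.RiemannHypothesis.RiemannHypothesis.Theorems.RobinHighStaircaseRowsH22to25
import Summits.RiemannHypothesis.RiemannHypothesis.Theorems.RobinHighStaircaseRowsH26to30
import Summits.RiemannHypothesis.RiemannHypothesis.Theorems.RobinHighStaircaseRowHTop
import Summits.RiemannHypothesis.RiemannHypothesis.Theorems.RobinHighStaircaseAssembly
import HarnessLib

/-!
# Route RobinHighStaircase (L21 / (ix-o) «ROBIN · HIGH STAIRCASE») — the target `HighStaircase` (item stmt-RiemannHypothesis-22026)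

With the four row items and the assembly item closed by name (files `RobinHighStaircaseRows*`, `…RowHTop`,
`…Assembly`), the target «under the two θ-prints, the fourteen RH(T)-rows (T ≥ 2.22·10⁶ / … / 1.22·10¹⁰ ⟹ CA primes
< 4^19 / … / 4^31; T ≥ 1.82·10¹⁰ ⟹ CA primes ≤ 10¹⁹)» is the assembly applied to the rows — exactly the route's
deciding term `closes h1 h2 h3 h4 hA = hA h1 h2 h3 h4`.
CONDITIONAL bookkeeping on the two printed θ-facts (Büthe 2018 Thm 2, BKLNW 2021) and `RiemannHypothesisUpTo T`
(hypotheses, not discharged); RH is not proved by this; nothing here bears on the truth of RH.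
-/

-- D-0017: `Summit.RiemannHypothesis.RiemannHypothesis.…` duplicates the namespace BY DESIGN (single-problem summit).
set_option linter.dupNamespace false

namespace Summit.RiemannHypothesis.RiemannHypothesis.Theorems.RobinHighStaircase

/-- **Target `HighStaircase` (item stmt-RiemannHypothesis-22026)** holds: the assembly applied to the four closed rows. -/
theorem highStaircase_proof :
    Summit.RiemannHypothesis.RiemannHypothesis.Theses.RobinHighStaircase.HighStaircase :=
  assembly_proof rowsH18to21_proof rowsH22to25_proof rowsH26to30_proof rowHTop_proof

end Summit.RiemannHypothesis.RiemannHypothesis.Theorems.RobinHighStaircase
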